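import Literature.Computability.AlgebraicComplexity.TauConjectureProofs
import Literature.Computability.Complexity.BinarySubtraction
import Literature.Computability.Complexity.CountingHierarchyPH
import HarnessLib

/-!
# The coefficients of the Pochhammer–Wilkinson polynomials are definable in `CH`, from Cor. 3.9 (proofs)

Sibling proof file of `TauConjectureProofs.lean` (D-0014). Bürgisser, ECCC TR06-113, proof of
Thm. 1.1(2), p. 15: "`f_n = ∏_{k=1}^{n} (X - k) = ∑_{k=0}^{n} (-1)^k σ_k(1, 2, …, n) X^{n-k}` …
Corollary 3.9 implies that its coefficient sequence is definable in `CH`." We PROVE this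
implication between the two named facts of the tree,

* `Burgisser2009_pochhammerWilkinson_coeff_chDefinable_of_esymm :
    Burgisser2009_esymm_chDefinable → Burgisser2009_pochhammerWilkinson_coeff_chDefinable`,

i.e. the passage from `(σ_k(1,…,n))_{n, k ≤ n}` to `(coeff_k f_n)_{n, k ≤ n} = ((-1)^{n-k} σ_{n-k})`:
(1) the bit language of `|coeff|` is the preimage of that of `σ` under the polynomial-time
reindexing `⟨bin n, bin k⟩ ↦ ⟨bin n, bin (n-k)⟩` (`BinarySubtraction.lean`, a verified stack
program), and `CH` is closed under polynomial-time preimages; (2) the sign language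
`{(n, k) | coeff_k f_n ≥ 0} = {(n, k) | n - k even}` (as `σ_{n-k}(1,…,n) > 0`,
`esymm_pwRoots_pos`) is the regular language "the parities (first bits) of `bin n` and `bin k`
agree", in `P ⊆ CH`; (3) the bit size is that of `σ`. With `BurgisserTransferProofs.lean` this
leaves Bürgisser's Thm. 1.1(2) resting on Cor. 3.9, Lemma 2.12, Lemma 2.5(2), Thm. 2.10 and the
application of Thm. 2.11 (`not_isPBounded_constantFreeComplexity_perPoly_of_tauConjecture_of_facts`).

## References

* P. Bürgisser, *On defining integers and proving arithmetic circuit lower bounds*, Comput.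
  Complexity 18 (2009) 81–103 = ECCC TR06-113, Def. 3.1, Cor. 3.9, proof of Thm. 1.1(2) (p. 15).
-/

noncomputable section

open Computability Literature.Computability.Complexity Literature.Computability.Complexity.Classes

namespace Literature.Computability.AlgebraicComplexity

/-! ### The elementary symmetric functions of `1, …, n` are positive -/

/-- `σ_m(1, 2, …, n) ≥ 1 > 0` for `m ≤ n` (a nonempty sum of products of positive integers). [folklore] -/
theorem esymm_pwRoots_pos {n m : ℕ} (hm : m ≤ n) : 0 < (pwRoots n).esymm m := by
  rw [Multiset.esymm]
  have hcard : Multiset.card (Multiset.powersetCard m (pwRoots n)) = n.choose m := by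
    rw [Multiset.card_powersetCard, card_pwRoots]
  obtain ⟨t₀, ht₀⟩ := Multiset.card_pos_iff_exists_mem.1 (by rw [hcard]; exact Nat.choose_pos hm)
  have hge : ∀ x ∈ (Multiset.powersetCard m (pwRoots n)).map Multiset.prod, (1 : ℤ) ≤ x := by
    intro x hx
    obtain ⟨t, ht, rfl⟩ := Multiset.mem_map.1 hx
    exact Multiset.one_le_prod fun y hy =>
      (mem_pwRoots_iff.1 (Multiset.mem_of_le (Multiset.mem_powersetCard.1 ht).1 hy)).1
  have h1 : (1 : ℤ) ≤ t₀.prod := hge _ (Multiset.mem_map_of_mem _ ht₀)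
  have h2 : t₀.prod ≤ ((Multiset.powersetCard m (pwRoots n)).map Multiset.prod).sum :=
    Multiset.single_le_sum (fun x hx => le_trans zero_le_one (hge x hx)) _ (Multiset.mem_map_of_mem _ ht₀)
  omega

/-- **Sign of the coefficients**: for `k ≤ n`, `coeff_k f_n ≥ 0 ↔ n - k` is even. [cite: Burgisser2006, proof of Thm. 1.1(2)] -/
theorem coeff_pochhammerWilkinson_nonneg_iff {n k : ℕ} (hk : k ≤ n) :
    0 ≤ (pochhammerWilkinson n).coeff k ↔ Even (n - k) := by
  rw [coeff_pochhammerWilkinson hk]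
  have hpos := esymm_pwRoots_pos (Nat.sub_le n k)
  rcases Nat.even_or_odd (n - k) with he | ho
  · rw [he.neg_one_pow, one_mul]
    exact ⟨fun _ => he, fun _ => hpos.le⟩
  · rw [ho.neg_one_pow, neg_one_mul, neg_nonneg]
    constructor
    · intro h; exact absurd hpos (not_lt.2 h)
    · intro h; exact absurd h (Nat.not_even_iff_odd.2 ho)

/-- **Absolute value of the coefficients**: `|coeff_k f_n| = σ_{n-k}(1,…,n)` as natural numbers. [cite: Burgisser2006, proof of Thm. 1.1(2)] -/
theorem natAbs_coeff_pochhammerWilkinson {n k : ℕ} (hk : k ≤ n) :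
    ((pochhammerWilkinson n).coeff k).natAbs = ((pwRoots n).esymm (n - k)).natAbs := by
  rw [coeff_pochhammerWilkinson hk, Int.natAbs_mul, Int.natAbs_pow, Int.natAbs_neg, Int.natAbs_one,
    one_pow, one_mul]

/-! ### The sign language: the parities of `n` and `k` agree -/

/-- The language "the first bits (parities) of the two components agree":
`{⟨u, w⟩ | u starts with 1 ↔ w starts with 1}` is in `P` (a Boolean combination of two regular
tests behind the pair projections). [folklore] -/
theorem paritiesAgree_mem_P :
    ({z | ((boolUnpair z).1).head? = some true ↔ ((boolUnpair z).2).head? = some true} : Language Bool) ∈ P := by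
  have hA : ({c | c.head? = some true} : Language Bool) ∈ P :=
    mem_P_of_fst (RegLang.startsWithT true) _ fun w =>
      ⟨fun hw => by
          have hw' : w.head? = some true := hw
          rw [RegLang.startsWithT_eval, decide_eq_true hw'],
        fun hw => by
          have hw' : ¬ w.head? = some true := hw
          rw [RegLang.startsWithT_eval, decide_eq_false hw']⟩
  have hA1 : ({z | ((boolUnpair z).1).head? = some true} : Language Bool) ∈ P :=
    preimage_mem_P (f := fun z => (boolUnpair z).1) hA boolUnpairFst_mem_FP
  have hA2 : sndStartsWith true ∈ P := sndStartsWith_mem_P true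
  have h := union_mem_P (inter_mem_P hA1 hA2)
    (inter_mem_P (compl_mem_P_iff.2 hA1) (compl_mem_P_iff.2 hA2))
  have heq : ({z | ((boolUnpair z).1).head? = some true} ⊓ sndStartsWith true ⊔
      (({z | ((boolUnpair z).1).head? = some true} : Language Bool)ᶜ ⊓ (sndStartsWith true)ᶜ) : Language Bool) =
      {z | ((boolUnpair z).1).head? = some true ↔ ((boolUnpair z).2).head? = some true} := by
    ext z
    change (((boolUnpair z).1.head? = some true ∧ (boolUnpair z).2.head? = some true) ∨
      (¬ (boolUnpair z).1.head? = some true ∧ ¬ (boolUnpair z).2.head? = some true)) ↔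
      ((boolUnpair z).1.head? = some true ↔ (boolUnpair z).2.head? = some true)
    tauto
  rwa [heq] at h

/-- Parity of a difference through the parities: for `k ≤ n`, `n - k` is even iff
`(n odd ↔ k odd)`. [folklore] -/
theorem even_sub_iff_mod_two {n k : ℕ} (hk : k ≤ n) : Even (n - k) ↔ (n % 2 = 1 ↔ k % 2 = 1) := by
  rw [Nat.even_iff]
  omega

/-! ### The implication Cor. 3.9 ⇒ coefficient sequence definable in `CH` -/

/-- **Bürgisser, proof of Thm. 1.1(2): "Corollary 3.9 implies that its coefficient sequence is
definable in `CH`"** — PROVED: from `Burgisser2009_esymm_chDefinable` (Cor. 3.9) to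
`Burgisser2009_pochhammerWilkinson_coeff_chDefinable` by the polynomial-time reindexing
`(n, k) ↦ (n, n-k)` on the bit language, the parity test for the sign language, and the same bit
size. [cite: Burgisser2006, proof of Thm. 1.1(2)] -/
theorem Burgisser2009_pochhammerWilkinson_coeff_chDefinable_of_esymm
    (h : Burgisser2009_esymm_chDefinable) : Burgisser2009_pochhammerWilkinson_coeff_chDefinable := by
  obtain ⟨hq, ⟨c, hc⟩, ⟨S, hS, hS'⟩, ⟨B, hB, hB'⟩⟩ := h
  refine ⟨hq, ⟨c, fun n k hn hk => ?_⟩, ⟨_, P_subset_CH paritiesAgree_mem_P, fun n k hk => ?_⟩,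
    ⟨mapFstFn reindexFn ⁻¹' B, preimage_mem_CH hB (mapFstFn_mem_FP reindexFn_mem_FP), fun n k j b hk => ?_⟩⟩
  · -- bit size
    have h1 := hc n (n - k) hn (Nat.sub_le n k)
    rw [← Int.natCast_natAbs] at h1 ⊢
    rwa [natAbs_coeff_pochhammerWilkinson hk]
  · -- sign language
    change (((boolUnpair (encIdx n k)).1).head? = some true ↔ ((boolUnpair (encIdx n k)).2).head? = some true) ↔ _
    rw [encIdx, boolUnpair_boolPair, head?_encodeNat_eq_some_true_iff, head?_encodeNat_eq_some_true_iff,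
      coeff_pochhammerWilkinson_nonneg_iff hk, even_sub_iff_mod_two hk]
  · -- bit language
    change mapFstFn reindexFn (encBitQuery n k j b) ∈ B ↔ _
    rw [encBitQuery, mapFstFn_boolPair, encIdx, reindexFn_encodeNat hk, ← encIdx, ← encBitQuery,
      hB' n (n - k) j b (Nat.sub_le n k), natAbs_coeff_pochhammerWilkinson hk]

end Literature.Computability.AlgebraicComplexity
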